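import Mathlib.MeasureTheory.Measure.HasOuterApproxClosed
import Mathlib.Topology.MetricSpace.Thickening
import Literature.Probability.RandomPlanarGeometry.CurveClassStopAtMeasurable
import Literature.Probability.RandomPlanarGeometry.KSRectangleExit
import HarnessLib

/-!
# Stopping on a closed set is the limit of stopping on its closed thickenings; laws of stopped curves pass to the limit

Topic `Probability/RandomPlanarGeometry`; theorems only. A technical step of the transposition of
the locality / splitting theorems of chordal SLE₆ (G. F. Lawler, O. Schramm, W. Werner, Acta Math.
**187** (2001), Thm. 2.2, Cor. 2.3–2.4; the tree's `ChordalFamily.IsLocal`,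
`IsSLELaw.locality_six`) to the stopped-curve-class form `μ (CurveClass.stopAt F ⁻¹' T)`: the
analytic engine controls the curve only up to times at which it keeps a positive distance from
the stopping set `F` (localisation), i.e. up to the hitting of the closed thickenings
`F_n = cthickening (1/(n+1)) F`; this file PROVES that nothing is lost in the limit `n → ∞`:

* `Curve.tendsto_hitParam_cthickening` — for closed `F`, `hitParam F_n γ ↑ hitParam F γ`
  (the hitting parameters increase to a limit `t⋆ ≤ T`; the hitting points `γ(t_n) ∈ F_n`
  accumulate at `γ(t⋆)`, which is therefore in `⋂ F_n = F`, forcing `T ≤ t⋆`);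
* `Curve.tendsto_stopAt_cthickening`, `CurveClass.tendsto_stopAt_cthickening` — hence the stopped
  curves and stopped classes converge, `stopAt F_n c → stopAt F c` for EVERY class `c`
  (uniform continuity of `γ ∘ affineClamp 0 t` in `t`, `Curve.tendsto_dist_comp_affineClamp`);
* `Measure.map_stopAt_eq_of_forall_cthickening`, `measure_preimage_stopAt_eq_of_forall_cthickening`
  — **two finite Borel measures on curve classes whose stopped laws agree on every `F_n` have the
  same stopped law on `F`** (dominated convergence on bounded continuous test functions and
  `ext_of_forall_lintegral_eq_of_IsFiniteMeasure`; measurability of `stopAt` for closed sets,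
  `CurveClass.measurable_stopAt`).

## References

* G. F. Lawler, O. Schramm, W. Werner, Acta Math. 187 (2001), §2 (the stopping times
  `T = sup{t : K̄_t ∩ I = ∅}`). [LawlerSchrammWerner2001]
* M. Aizenman, A. Burchard, Duke Math. J. 99 (1999), §2.1 (the curve space). [AizenmanBurchard1999]
-/

noncomputable section

open Set Filter Metric MeasureTheory
open _root_.Topology
open scoped unitInterval ENNReal NNReal BoundedContinuousFunction

namespace Literature.Probability.RandomPlanarGeometry

namespace Curve

/-! ### Thickenings: the hitting parameter and the stopped curve pass to the limit -/

section Metric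

variable {E : Type*} [MetricSpace E]

/-- **`hitParam (cthickening (1/(n+1)) F) γ → hitParam F γ`** for closed `F`. [folklore] -/
theorem tendsto_hitParam_cthickening {F : Set E} (hF : IsClosed F) (γ : Curve E) :
    Tendsto (fun n : ℕ ↦ γ.hitParam (cthickening (1 / ((n : ℝ) + 1)) F)) atTop (𝓝 (γ.hitParam F)) := by
  set t : ℕ → ℝ := fun n ↦ γ.hitParam (cthickening (1 / ((n : ℝ) + 1)) F) with ht
  set T : ℝ := γ.hitParam F with hT
  -- monotone and bounded by `T`
  have hsubF : ∀ n : ℕ, F ⊆ cthickening (1 / ((n : ℝ) + 1)) F := fun n ↦ self_subset_cthickening F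
  have htT : ∀ n : ℕ, t n ≤ T := fun n ↦ hitParam_mono (hsubF n) γ
  have hmono : Monotone t := by
    refine monotone_nat_of_le_succ fun n ↦ hitParam_mono (cthickening_mono ?_ F) γ
    push_cast
    exact one_div_le_one_div_of_le (by positivity) (by linarith)
  have hbdd : BddAbove (range t) := ⟨T, by rintro _ ⟨n, rfl⟩; exact htT n⟩
  have hconv : Tendsto t atTop (𝓝 (⨆ n, t n)) := tendsto_atTop_ciSup hmono hbdd
  set L : ℝ := ⨆ n, t n with hL
  have hLT : L ≤ T := ciSup_le htT
  suffices hTL : T ≤ L by rw [le_antisymm hLT hTL] at hconv; exact hconv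
  -- either some thickening is never met (then `t n = 1 ≥ T`), or all hitting points lie in the thickenings
  by_cases hmeet : ∀ n : ℕ, ∃ s, γ s ∈ cthickening (1 / ((n : ℝ) + 1)) F
  · have hLmem : L ∈ Icc (0 : ℝ) 1 :=
      ⟨(γ.hitParam_mem_Icc _).1.trans (le_ciSup hbdd 0), hLT.trans (γ.hitParam_mem_Icc F).2⟩
    -- `γ L ∈ F`
    have hpt : ∀ n : ℕ, γ ⟨t n, γ.hitParam_mem_Icc _⟩ ∈ cthickening (1 / ((n : ℝ) + 1)) F :=
      fun n ↦ apply_hitParam_mem isClosed_cthickening (hmeet n)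
    have hlimI : Tendsto (fun n : ℕ ↦ (⟨t n, γ.hitParam_mem_Icc _⟩ : I)) atTop (𝓝 ⟨L, hLmem⟩) := by
      rw [tendsto_subtype_rng]; exact hconv
    have hγlim : Tendsto (fun n : ℕ ↦ γ ⟨t n, γ.hitParam_mem_Icc _⟩) atTop (𝓝 (γ ⟨L, hLmem⟩)) :=
      (γ.continuous.tendsto _).comp hlimI
    have hmemF : γ ⟨L, hLmem⟩ ∈ F := by
      -- in every `F_m` (closed, containing the tail of the hitting points), hence in `closure F = F`
      have hm : ∀ m : ℕ, γ ⟨L, hLmem⟩ ∈ cthickening (1 / ((m : ℝ) + 1)) F := by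
        intro m
        refine isClosed_cthickening.mem_of_tendsto hγlim (eventually_atTop.2 ⟨m, fun n hn ↦ ?_⟩)
        refine cthickening_mono ?_ F (hpt n)
        have hmn : (m : ℝ) ≤ n := by exact_mod_cast hn
        exact one_div_le_one_div_of_le (by positivity) (by linarith)
      rw [← hF.closure_eq, Metric.mem_closure_iff_infEDist_zero]
      refine le_antisymm (le_of_forall_pos_le_add fun ε hε ↦ ?_) bot_le
      rw [zero_add]
      rcases eq_or_ne ε ⊤ with rfl | hεtop
      · exact le_top
      obtain ⟨m, hm'⟩ := exists_nat_one_div_lt (ENNReal.toReal_pos hε.ne' hεtop)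
      have := (mem_cthickening_iff.1 (hm m)).trans (ENNReal.ofReal_le_ofReal hm'.le)
      rwa [ENNReal.ofReal_toReal hεtop] at this
    exact hitParam_le (F := F) hmemF
  · push Not at hmeet
    obtain ⟨n, hn⟩ := hmeet
    have h1 : t n = 1 := hitParam_eq_one_of_forall_notMem hn
    exact ((γ.hitParam_mem_Icc F).2.trans_eq h1.symm).trans (le_ciSup hbdd n)

/-- **`stopAt (cthickening (1/(n+1)) F) γ → stopAt F γ`** for closed `F` (reparametrisation
metric). [folklore] -/
theorem tendsto_stopAt_cthickening {F : Set E} (hF : IsClosed F) (γ : Curve E) :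
    Tendsto (fun n : ℕ ↦ γ.stopAt (cthickening (1 / ((n : ℝ) + 1)) F)) atTop (𝓝 (γ.stopAt F)) := by
  have hlim := tendsto_hitParam_cthickening hF γ
  have hlimI : Tendsto (fun n : ℕ ↦ (⟨γ.hitParam (cthickening (1 / ((n : ℝ) + 1)) F), γ.hitParam_mem_Icc _⟩ : I))
      atTop (𝓝 ⟨γ.hitParam F, γ.hitParam_mem_Icc F⟩) := by
    rw [tendsto_subtype_rng]; exact hlim
  have h := tendsto_dist_comp_affineClamp γ hlimI (fun _ ↦ 0) (fun u ↦ u)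
    (fun u v ↦ by simp) (fun u v ↦ le_rfl)
  rw [tendsto_iff_dist_tendsto_zero]
  refine h.congr fun n ↦ ?_
  rw [dist_comm]
  rfl

/-- The hitting parameters of the closed thickenings are bounded by the hitting parameter of `F`
(`F ⊆ cthickening r F`, antitonicity of `hitParam`). [folklore] -/
theorem hitParam_cthickening_le (F : Set E) (γ : Curve E) (r : ℝ) :
    γ.hitParam (cthickening r F) ≤ γ.hitParam F :=
  hitParam_mono (self_subset_cthickening F) γ

end Metric

end Curve

namespace CurveClass

variable {E : Type*} [MetricSpace E]

/-- **`stopAt (cthickening (1/(n+1)) F) c → stopAt F c`** for every curve class and closed `F`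
(through the chosen representative; `mk` is continuous). [folklore] -/
theorem tendsto_stopAt_cthickening {F : Set E} (hF : IsClosed F) (c : CurveClass E) :
    Tendsto (fun n : ℕ ↦ stopAt (cthickening (1 / ((n : ℝ) + 1)) F) c) atTop (𝓝 (stopAt F c)) :=
  (continuous_mk.tendsto _).comp (Curve.tendsto_stopAt_cthickening hF c.out)

end CurveClass

/-! ### Laws of stopped classes pass to the limit -/

/-- **Stopped laws pass to the limit of the thickenings.** If two finite Borel measures on planar
curve classes have the same push-forward under `stopAt (cthickening (1/(n+1)) F)` for every `n`
(`F` closed), they have the same push-forward under `stopAt F`: for a bounded continuous test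
function `g`, `∫ g ∘ stopAt F_n → ∫ g ∘ stopAt F` under both measures (dominated convergence),
and finite Borel measures on a metric space are determined by such integrals. [folklore] -/
theorem Measure.map_stopAt_eq_of_forall_cthickening {μ ν : Measure (CurveClass ℂ)} [IsFiniteMeasure μ]
    [IsFiniteMeasure ν] {F : Set ℂ} (hF : IsClosed F)
    (h : ∀ n : ℕ, μ.map (CurveClass.stopAt (cthickening (1 / ((n : ℝ) + 1)) F)) =
      ν.map (CurveClass.stopAt (cthickening (1 / ((n : ℝ) + 1)) F))) :
    μ.map (CurveClass.stopAt F) = ν.map (CurveClass.stopAt F) := by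
  have hm : Measurable (CurveClass.stopAt F : CurveClass ℂ → CurveClass ℂ) := CurveClass.measurable_stopAt hF
  have hmn : ∀ n : ℕ, Measurable (CurveClass.stopAt (cthickening (1 / ((n : ℝ) + 1)) F) : CurveClass ℂ → CurveClass ℂ) :=
    fun n ↦ CurveClass.measurable_stopAt isClosed_cthickening
  haveI : IsFiniteMeasure (μ.map (CurveClass.stopAt F)) := Measure.isFiniteMeasure_map μ _
  refine ext_of_forall_lintegral_eq_of_IsFiniteMeasure fun g ↦ ?_
  -- both sides are limits of the same sequence
  have key : ∀ (ρ : Measure (CurveClass ℂ)) [IsFiniteMeasure ρ],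
      Tendsto (fun n : ℕ ↦ ∫⁻ c, g c ∂(ρ.map (CurveClass.stopAt (cthickening (1 / ((n : ℝ) + 1)) F))))
        atTop (𝓝 (∫⁻ c, g c ∂(ρ.map (CurveClass.stopAt F)))) := by
    intro ρ _
    simp_rw [lintegral_map g.continuous.measurable.coe_nnreal_ennreal (hmn _),
      lintegral_map g.continuous.measurable.coe_nnreal_ennreal hm]
    refine tendsto_lintegral_of_dominated_convergence (fun _ ↦ (nndist g 0 : ℝ≥0∞))
      (fun n ↦ (g.continuous.measurable.coe_nnreal_ennreal.comp (hmn n))) (fun n ↦ Eventually.of_forall fun c ↦ ?_)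
      ?_ (Eventually.of_forall fun c ↦ ?_)
    · exact ENNReal.coe_le_coe.2 (BoundedContinuousFunction.NNReal.upper_bound g _)
    · rw [lintegral_const]; exact ENNReal.mul_ne_top ENNReal.coe_ne_top (measure_ne_top _ _)
    · exact ((ENNReal.continuous_coe.comp g.continuous).tendsto _).comp (CurveClass.tendsto_stopAt_cthickening hF c)
  have h1 := key μ
  have h2 := key ν
  simp_rw [h] at h1
  exact tendsto_nhds_unique h1 h2

/-- **Preimage form** (the form of `ChordalFamily.IsLocal` / `IsSLELaw.locality_six`): if
`μ (stopAt F_n ⁻¹' T) = ν (stopAt F_n ⁻¹' T)` for all `n` and all Borel `T`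
(`F_n = cthickening (1/(n+1)) F`, `F` closed), then `μ (stopAt F ⁻¹' T) = ν (stopAt F ⁻¹' T)` for
all Borel `T`. [folklore] -/
theorem measure_preimage_stopAt_eq_of_forall_cthickening {μ ν : Measure (CurveClass ℂ)} [IsFiniteMeasure μ]
    [IsFiniteMeasure ν] {F : Set ℂ} (hF : IsClosed F)
    (h : ∀ n : ℕ, ∀ T : Set (CurveClass ℂ), MeasurableSet T →
      μ (CurveClass.stopAt (cthickening (1 / ((n : ℝ) + 1)) F) ⁻¹' T) =
        ν (CurveClass.stopAt (cthickening (1 / ((n : ℝ) + 1)) F) ⁻¹' T))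
    {T : Set (CurveClass ℂ)} (hT : MeasurableSet T) :
    μ (CurveClass.stopAt F ⁻¹' T) = ν (CurveClass.stopAt F ⁻¹' T) := by
  have hm : Measurable (CurveClass.stopAt F : CurveClass ℂ → CurveClass ℂ) := CurveClass.measurable_stopAt hF
  have hmn : ∀ n : ℕ, Measurable (CurveClass.stopAt (cthickening (1 / ((n : ℝ) + 1)) F) : CurveClass ℂ → CurveClass ℂ) :=
    fun n ↦ CurveClass.measurable_stopAt isClosed_cthickening
  have hmap : ∀ n : ℕ, μ.map (CurveClass.stopAt (cthickening (1 / ((n : ℝ) + 1)) F)) =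
      ν.map (CurveClass.stopAt (cthickening (1 / ((n : ℝ) + 1)) F)) := fun n ↦
    Measure.ext fun T hT ↦ by rw [Measure.map_apply (hmn n) hT, Measure.map_apply (hmn n) hT]; exact h n T hT
  have := Measure.map_stopAt_eq_of_forall_cthickening hF hmap
  have h' := congrArg (fun ρ : Measure (CurveClass ℂ) ↦ ρ T) this
  simpa only [Measure.map_apply hm hT] using h'

end Literature.Probability.RandomPlanarGeometry

end
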